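import Literature.Computability.Complexity.FourierTails
import Literature.Computability.Complexity.FourierDegree
import HarnessLib

/-!
# Crux `MobiusLadder.LiouvilleOrthogonalTC0` (stmt-QuantumAdvantage-1393): the leaf bound of the
threshold-of-AC⁰ rung — a real threshold of shallow decision trees is a low-degree PTF

Line `Sketch`, skeleton v11 (lead `prover-line-stmt-QuantumAdvantage-1393-c6-0`), registered stub
`stub_thrLeaf`. At a good leaf of the random-restriction tree every `AC⁰` sub-circuit of a threshold
gate has collapsed to a decision tree `T a` of depth `≤ ℓ`, and the restricted function is
`x ↦ b ⊕ [θ ≤ Σ_a w_a [T_a(x)]]`. The real function `q(x) = Σ_a w_a [T_a(x)] − θ` has Fourier degree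
`≤ ℓ`: each `[T_a(·)]` has no coefficient above level `depth (T a) ≤ ℓ`
(`cubeFourierCoeff_decisionTree_eq_zero`, Tal 2017 §3), and coefficients are linear
(`cubeFourierCoeff_sub`, `cubeFourierCoeff_const_mul`, `cubeFourierCoeff_const`, finite sums). Since
`[θ ≤ s] = [0 ≤ s − θ]`, the function is the (possibly negated) polynomial threshold function
`sgn (b ⊕ [0 ≤ q])`, and the uniform PTF tail bound `hPTF` (the v10 theorem `tailWeight_ptf_le`,
here a hypothesis) gives `W^{≥D} ≤ 6 D^{−1/2^ℓ} + 3/√D`.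

* `StubThrLeaf.cubeFourierCoeff_fintype_sum` — `(∑ₐ gₐ)^(S) = ∑ₐ ĝₐ(S)`;
* `StubThrLeaf.cubeFourierCoeff_thr_eq_zero`, `StubThrLeaf.fourierDegree_thr_le` — `deg q ≤ ℓ`;
* `stub_thrLeaf` — the registered stub, verbatim.
-/

set_option linter.dupNamespace false -- D-0017: single-problem summit ⇒ `QuantumAdvantage.QuantumAdvantage` by design

noncomputable section

namespace Summit.QuantumAdvantage.QuantumAdvantage.Theorems.LiouvilleOrthogonalTC0

open Finset
open Literature.Computability.Complexity Literature.Computability.Complexity.LowDegree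
open Literature.Probability.RandomGraphs.LowDegree (sgn)

namespace StubThrLeaf

/-- Finite additivity of the cube Fourier coefficients over a `Fin K`-indexed family:
`(∑ₐ gₐ)^(S) = ∑ₐ ĝₐ(S)`. -/
theorem cubeFourierCoeff_fintype_sum {n K : ℕ} (g : Fin K → (Fin n → Bool) → ℝ)
    (S : Finset (Fin n)) :
    cubeFourierCoeff (fun x => ∑ a, g a x) S = ∑ a, cubeFourierCoeff (g a) S := by
  -- adapted from `LowDegree.cubeFourierCoeff_sum` (`FourierDegreeAlgebra.lean`)
  unfold cubeFourierCoeff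
  rw [← Finset.sum_div]
  congr 1
  rw [Finset.sum_comm]
  exact Finset.sum_congr rfl fun x _ => by rw [Finset.sum_mul]

/-- The coefficients of the real reading `x ↦ Σ_a w_a [T_a(x)] − θ` of a weighted family of
decision trees of depth `≤ ℓ` vanish at every set of more than `ℓ` coordinates. -/
theorem cubeFourierCoeff_thr_eq_zero {n K ℓ : ℕ} (T : Fin K → DecisionTree n)
    (hT : ∀ a, (T a).depth ≤ ℓ) (w : Fin K → ℝ) (θ : ℝ) {S : Finset (Fin n)} (hS : ℓ < S.card) :
    cubeFourierCoeff (fun x : Fin n → Bool =>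
      (∑ a, w a * (if (T a).eval x then (1 : ℝ) else 0)) - θ) S = 0 := by
  have hne : S ≠ ∅ := by
    rintro rfl
    simp at hS
  rw [cubeFourierCoeff_sub (fun x => ∑ a, w a * (if (T a).eval x then (1 : ℝ) else 0)) (fun _ => θ) S,
    cubeFourierCoeff_const hne, sub_zero,
    cubeFourierCoeff_fintype_sum (fun a x => w a * (if (T a).eval x then (1 : ℝ) else 0)) S]
  refine Finset.sum_eq_zero fun a _ => ?_
  rw [cubeFourierCoeff_const_mul (w a) (fun x => if (T a).eval x then (1 : ℝ) else 0) S,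
    cubeFourierCoeff_decisionTree_eq_zero (fun c => if c then (1 : ℝ) else 0) (T a) S
      ((hT a).trans_lt hS), mul_zero]

/-- Hence `x ↦ Σ_a w_a [T_a(x)] − θ` has Fourier degree `≤ ℓ` when every `T a` has depth `≤ ℓ`. -/
theorem fourierDegree_thr_le {n K ℓ : ℕ} (T : Fin K → DecisionTree n)
    (hT : ∀ a, (T a).depth ≤ ℓ) (w : Fin K → ℝ) (θ : ℝ) :
    fourierDegree (fun x : Fin n → Bool =>
      (∑ a, w a * (if (T a).eval x then (1 : ℝ) else 0)) - θ) ≤ ℓ := by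
  classical
  unfold fourierDegree
  refine Finset.sup_le fun S hS => ?_
  simp only [Finset.mem_filter, Finset.mem_univ, true_and] at hS
  by_contra hlt
  exact hS (cubeFourierCoeff_thr_eq_zero T hT w θ (not_le.mp hlt))

end StubThrLeaf

/-- **Stub T2 (wave 4, v11) — the leaf bound: a real threshold of shallow decision trees is a
bounded-degree PTF.** If every `T a` has depth `≤ ℓ` then `x ↦ Σ_a w_a [T_a(x)] − θ` has Fourier
degree `≤ ℓ` (`cubeFourierCoeff_decisionTree_eq_zero` + linearity of coefficients), so by the v10
uniform PTF tail — taken as the hypothesis `hPTF` (= `tailWeight_ptf_le` of `…TC0PtfPeriodic.lean`) —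
`W^{≥D}[sgn(b ⊕ [θ ≤ Σ_a w_a T_a])] ≤ 6 D^{−1/2^ℓ} + 3/√D`. -/
theorem stub_thrLeaf
    (hPTF : ∀ (n d : ℕ) (q : (Fin n → Bool) → ℝ), fourierDegree q ≤ d → ∀ (b : Bool) (m : ℕ), 1 ≤ m →
      tailWeight (fun x : Fin n → Bool => sgn (xor b (decide (0 ≤ q x)))) m
        ≤ 6 * (m : ℝ) ^ (-(1 / (2 : ℝ) ^ d)) + 3 / Real.sqrt m)
    {n K ℓ D : ℕ} (T : Fin K → DecisionTree n) (hT : ∀ a, (T a).depth ≤ ℓ)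
    (w : Fin K → ℝ) (θ : ℝ) (b : Bool) (hD : 1 ≤ D) :
    tailWeight (fun x : Fin n → Bool =>
        sgn (xor b (decide (θ ≤ ∑ a, w a * (if (T a).eval x then (1 : ℝ) else 0))))) D
      ≤ 6 * (D : ℝ) ^ (-(1 / (2 : ℝ) ^ ℓ)) + 3 / Real.sqrt D := by
  have hfun : (fun x : Fin n → Bool =>
        sgn (xor b (decide (θ ≤ ∑ a, w a * (if (T a).eval x then (1 : ℝ) else 0))))) =
      fun x => sgn (xor b (decide (0 ≤
        (∑ a, w a * (if (T a).eval x then (1 : ℝ) else 0)) - θ))) := by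
    funext x
    rw [Bool.decide_congr (sub_nonneg (a := ∑ a, w a * (if (T a).eval x then (1 : ℝ) else 0))
      (b := θ)).symm]
  rw [hfun]
  exact hPTF n ℓ _ (StubThrLeaf.fourierDegree_thr_le T hT w θ) b D hD

end Summit.QuantumAdvantage.QuantumAdvantage.Theorems.LiouvilleOrthogonalTC0
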